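import Summits.CriticalPhenomena.CardyFormulaZ2.Theorems.CardyFlipRussoVoronoiHubFromSmirnovDefLocOfDefSq
import Summits.CriticalPhenomena.CardyFormulaZ2.Theorems.CardyFlipRussoVoronoiHubFromSmirnovUnitWFixed
import Summits.CriticalPhenomena.CardyFormulaZ2.Theorems.CardyFlipRussoVoronoiHubFromSmirnovOneArmScales
import Summits.CriticalPhenomena.CardyFormulaZ2.Theorems.CardyFlipRussoVoronoiHubFromSmirnovTransportBilipschitz
import Summits.CriticalPhenomena.CardyFormulaZ2.Theorems.CardyFlipRussoVoronoiHubFromSmirnovUniformDefectPackage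
import Summits.CriticalPhenomena.CardyFormulaZ2.Theorems.CardyFlipRussoVoronoiHubFromSmirnovFarAttachment
import Summits.CriticalPhenomena.CardyFormulaZ2.Theorems.CardyFlipRussoVoronoiHubFromSmirnovVoidGlobal
import Summits.CriticalPhenomena.CardyFormulaZ2.Theorems.CardyFlipRussoVoronoiHubFromSmirnovArmLoc
import Summits.CriticalPhenomena.CardyFormulaZ2.Theorems.CardyFlipRussoVoronoiHubFromSmirnovGraphTransportOfUnitW
import Summits.CriticalPhenomena.CardyFormulaZ2.Theorems.CardyFlipRussoVoronoiHubFromSmirnovGraphLaw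

/-!
# The S3b-i core of line `moebius-exact-delaunay-dilation-ward`: graph transport from Tassion's
# one-arm decay (final assembly; lead c3)

Crux `VoronoiHubFromSmirnov` (stmt-CriticalPhenomena-6433), route `CardyFlipRusso`.  `unitW_of_inputs`
assembles the image-side core `Sig.unitW` from the landed bricks of the one-arm route and three
inputs given as hypotheses (their registered statements): the per-square probability bound
(`perSquare_bound`), the eventual numerical fits (`scales_eventually`) and the decay of the final
error (`FS_tendsto_zero`).  With those landed, `unitW_of_oneArm : VoronoiAnnealedOneArm → Sig.unitW`
and the registered skeleton stub `stub_graphTransportCore = fun h => stub_graphTransport_of_unitW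
(unitW_of_oneArm h)` follow by name.

Route of the proof (module docstring of `…OneArmDefs`): transport to the image side is already done
(`Sig.unitW` is image-side); switch the adjacency square by square (`hybEvent`, `abs_window_sub_pull_le`)
on the no-void event; a step costs a defective square (local potential defect, `vc_defLoc_of_defSq`,
`potDef_bound_*`) AND a chain arm (`armLoc_bound`, Tassion) on disjoint regions
(`stepBad_measure_le_R`, `perSquare_bound`); sum over the `O(δ⁻² u⁻²)` squares of the box; all side
conditions hold for small mesh (`scales_eventually`) and the total error `FS(δ) → 0` (`FS_tendsto_zero`).
-/

noncomputable section

namespace Summit.CriticalPhenomena.CardyFormulaZ2.Cruxes.VoronoiHubFromSmirnov.MoebiusExactDelaunayDilationWard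

open Set Metric MeasureTheory Filter
open scoped Topology
open Literature.Analysis.FunctionSpaces
open Literature.Probability.RandomPlanarGeometry
open Literature.Probability.LatticeModels (IsDelaunayPair voronoiCell)

/-! ### Small helpers -/

/-- The Lemma-4.2 package is monotone in the tolerance constant. -/
theorem defectPackage_mono_W {f : ℂ → ℂ} {B : Set ℂ} {W W₁ ℓ₀ : ℝ} (hW : W ≤ W₁)
    (hD : ∀ (ω : Set ℂ) (p q : ℂ) (ℓ : ℝ), ω ⊆ B → (∀ K : Set ℂ, IsCompact K → (ω ∩ K).Finite) →
      p ∈ ω → q ∈ ω → p ≠ q → 0 < ℓ → ℓ ≤ ℓ₀ → closedBall p (4 * ℓ) ⊆ B →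
      voronoiCell ω p ⊆ closedBall p ℓ → IsDelaunayPair ω p q →
      ¬ IsDelaunayPair (f '' ω) (f p) (f q) →
      (∃ (x a b : ℂ), a ∈ ω ∧ b ∈ ω ∧ a ≠ b ∧ a ≠ p ∧ a ≠ q ∧ b ≠ p ∧ b ≠ q ∧
        dist p x = dist q x ∧ dist p x ≤ ℓ ∧ (∀ d ∈ ω, dist p x ≤ dist d x) ∧
        dist a x = dist b x ∧ dist a x < dist p x + W * ℓ ^ 3) ∨
      (∃ a ∈ ω, a ≠ p ∧ a ≠ q ∧ (dist a p < W * ℓ ^ 3 ∨ dist a q < W * ℓ ^ 3))) :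
    ∀ (ω : Set ℂ) (p q : ℂ) (ℓ : ℝ), ω ⊆ B → (∀ K : Set ℂ, IsCompact K → (ω ∩ K).Finite) →
      p ∈ ω → q ∈ ω → p ≠ q → 0 < ℓ → ℓ ≤ ℓ₀ → closedBall p (4 * ℓ) ⊆ B →
      voronoiCell ω p ⊆ closedBall p ℓ → IsDelaunayPair ω p q →
      ¬ IsDelaunayPair (f '' ω) (f p) (f q) →
      (∃ (x a b : ℂ), a ∈ ω ∧ b ∈ ω ∧ a ≠ b ∧ a ≠ p ∧ a ≠ q ∧ b ≠ p ∧ b ≠ q ∧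
        dist p x = dist q x ∧ dist p x ≤ ℓ ∧ (∀ d ∈ ω, dist p x ≤ dist d x) ∧
        dist a x = dist b x ∧ dist a x < dist p x + W₁ * ℓ ^ 3) ∨
      (∃ a ∈ ω, a ≠ p ∧ a ≠ q ∧ (dist a p < W₁ * ℓ ^ 3 ∨ dist a q < W₁ * ℓ ^ 3)) := by
  intro ω p q ℓ h1 h2 h3 h4 h5 h6 h7 h8 h9 h10 h11
  have hmono : W * ℓ ^ 3 ≤ W₁ * ℓ ^ 3 := mul_le_mul_of_nonneg_right hW (by positivity)
  rcases hD ω p q ℓ h1 h2 h3 h4 h5 h6 h7 h8 h9 h10 h11 with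
    ⟨x, a, b, ha, hb, n1, n2, n3, n4, n5, e1, e2, e3, e4, e5⟩ | ⟨a, ha, n1, n2, hlt⟩
  · exact Or.inl ⟨x, a, b, ha, hb, n1, n2, n3, n4, n5, e1, e2, e3, e4, e5.trans_le (by linarith)⟩
  · refine Or.inr ⟨a, ha, n1, n2, ?_⟩
    rcases hlt with h | h
    · exact Or.inl (h.trans_le hmono)
    · exact Or.inr (h.trans_le hmono)

/-- The box of squares: indices with both coordinates in `[-M, M]`. -/
theorem sqIdx_mem_box {u ρ δ : ℝ} (hu : 0 < u) (hδ : 0 < δ) {M : ℕ} (hM : ρ / (δ * u) ≤ M) {p : ℂ}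
    (hp : ‖(δ : ℂ) * p‖ ≤ ρ) :
    sqIdx u p ∈ (Finset.Icc (-(M : ℤ)) M) ×ˢ (Finset.Icc (-(M : ℤ)) M) := by
  have hδ' : ‖(δ : ℂ) * p‖ = δ * ‖p‖ := by rw [norm_mul, Complex.norm_real, Real.norm_eq_abs, abs_of_pos hδ]
  have hpn : ‖p‖ ≤ ρ / δ := by rw [le_div_iff₀ hδ]; linarith [hδ', hp]
  have hre : |p.re| ≤ ρ / δ := (Complex.abs_re_le_norm p).trans hpn
  have him : |p.im| ≤ ρ / δ := (Complex.abs_im_le_norm p).trans hpn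
  have hMu : ρ / δ / u ≤ M := by rwa [div_div]
  have key : ∀ t : ℝ, |t| ≤ ρ / δ → ⌊t / u⌋ ∈ Finset.Icc (-(M : ℤ)) M := by
    intro t ht
    rw [abs_le] at ht
    have h1 : t / u ≤ M := (div_le_div_of_nonneg_right ht.2 hu.le).trans hMu
    have h2 : -(M : ℝ) ≤ t / u := by
      have : -(ρ / δ) / u ≤ t / u := div_le_div_of_nonneg_right ht.1 hu.le
      rw [neg_div] at this
      linarith
    rw [Finset.mem_Icc]
    constructor
    · have : (-(M : ℤ) : ℝ) ≤ t / u := by push_cast; exact h2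
      exact Int.le_floor.2 (by exact_mod_cast this)
    · exact Int.floor_le_iff.2 (by push_cast; linarith)
  exact Finset.mem_product.2 ⟨key _ hre, key _ him⟩


/-- The box of squares, ∀-form (registered glue sub-goal of this module). -/
theorem sqIdx_mem_box' : ∀ (u ρ δ : ℝ) (M : ℕ) (p : ℂ), 0 < u → 0 < δ → ρ / (δ * u) ≤ M → ‖(δ : ℂ) * p‖ ≤ ρ → sqIdx u p ∈ (Finset.Icc (-(M : ℤ)) M) ×ˢ (Finset.Icc (-(M : ℤ)) M) :=
  fun _ _ _ _ _ hu hδ hM hp => sqIdx_mem_box hu hδ hM hp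

/-! ### The assembly -/

set_option maxHeartbeats 800000 in
/-- **The image-side core from Tassion's one-arm decay, given the three analytic inputs** (their
registered statements: the per-square bound, the eventual numerical fits, the decay of the final
error).  See the module docstring for the route. -/
theorem unitW_of_inputs
    (hPS : ∀ (g : ℂ → ℂ) (V Kc K : Set ℂ) (δ r_v Λ m₁ u R m Ca ηa v p τ τ' : ℝ) (T : Finset (ℤ × ℤ)) (i : ℤ × ℤ), 0 < δ → 0 < r_v → 1 ≤ Λ → V ⊆ Kc → 2 * r_v ≤ u → 0 < u → 1 ≤ 100 * u → K ⊆ Kc → (∀ x ∈ K, Metric.closedBall x m₁ ⊆ V) → MeasurableSet K → 2 * r_v ≤ m₁ / δ - r_v → 0 < τ → τ ≤ 2 * r_v → 0 < τ' → τ' ≤ 2 * Λ * r_v → Measurable g → 0 < m → (∀ k ∈ T, ∀ x ∈ Metric.closedBall ((δ : ℂ) * sqCentre u k) (δ * (2 * u)), HasDerivAt g (deriv g x) x ∧ m ≤ ‖deriv g x‖) → (∀ k ∈ T, Set.InjOn g (Metric.closedBall ((δ : ℂ) * sqCentre u k) (δ * (2 * u)))) → 400 * u < R → (∀ x : ℂ,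 dist x (sqCentre u i) ≤ R + 8 * u → (δ : ℂ) * x ∈ V) → 0 ≤ Ca → 0 < ηa → (∀ (D D' K' : Set ℂ) (z : ℂ) (r₁ r₂ ℓ δ' : ℝ), 0 < δ' → 0 < ℓ → 1 ≤ r₁ → r₁ ≤ r₂ → Metric.cthickening (3 * ℓ) D' ⊆ D → (lawBW (MeasureTheory.volume : MeasureTheory.Measure ℂ)).real {c | ChainArm (adjEuc D c) z r₁ r₂ K' δ' ((c.1 : Set ℂ) ∩ D')} ≤ Ca * (r₁ / r₂) ^ ηa + (lawBW (MeasureTheory.volume : MeasureTheory.Measure ℂ)).real {c | ∃ x ∈ Metric.cthickening (2 * ℓ) D', ∀ y ∈ (c.1 : Set ℂ), ℓ / 2 ≤ dist y x}) → 0 ≤ v → (lawBW (MeasureTheory.volume : MeasureTheory.Measure ℂ)).real {c | ∃ z ∈ Kc, ∀ x ∈ (c.1 : Set ℂ), r_v ≤ dist x (z / (δ : ℂ))} ≤ v → i ∈ T → (∀ k ∈ T, ∀ c : Literature.Analysis.FunctionSpaces.PointConfig ℂ × Literature.Analysis.FunctionSpaces.PointConfig ℂ, (∀ z ∈ Kc,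 ∃ x ∈ (c.1 : Set ℂ), dist x (z / (δ : ℂ)) < r_v) → DefSq (adjEuc {b : ℂ | (δ : ℂ) * b ∈ V} c) (adjPull g V δ c) u k K δ (c.1 : Set ℂ) → NearTie ((((c.1 : Set ℂ) ∪ (c.2 : Set ℂ))) ∩ Metric.closedBall (sqCentre u k) (2 * u)) (sqCentre u k) (u + 2 * r_v) (2 * r_v) τ ∨ ClosePair ((((c.1 : Set ℂ) ∪ (c.2 : Set ℂ))) ∩ Metric.closedBall (sqCentre u k) (2 * u)) (sqCentre u k) (u + 6 * r_v) τ ∨ NearTie (transportMap g δ '' ((((c.1 : Set ℂ) ∪ (c.2 : Set ℂ))) ∩ Metric.closedBall (sqCentre u k) (2 * u))) (transportMap g δ (sqCentre u k)) (Λ * u + 2 * Λ * r_v) (2 * Λ * r_v) τ' ∨ ClosePair (transportMap g δ '' ((((c.1 : Set ℂ) ∪ (c.2 : Set ℂ))) ∩ Metric.closedBall (sqCentre u k) (2 * u))) (transportMap g δ (sqCentre u k)) (Λ * u + 3 * (2 * Λ * r_v)) τ') → (4 * (u + 2 * r_v) / τ + 1) ^ 2 * (4 * (2 * r_v) / τ)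 * ((36 * Real.pi * 2 * τ * (2 * r_v)) ^ 4 / 24) + (4 * (u + 6 * r_v) / τ + 1) ^ 2 * ((2 * Real.pi * (2 * τ) ^ 2) ^ 2 / 2) + (4 * (Λ * u + 2 * Λ * r_v) / τ' + 1) ^ 2 * (4 * (2 * Λ * r_v) / τ') * ((36 * Real.pi * (2 / m ^ 2) * τ' * (2 * Λ * r_v)) ^ 4 / 24) + (4 * (Λ * u + 3 * (2 * Λ * r_v)) / τ' + 1) ^ 2 * (((2 / m ^ 2) * Real.pi * (2 * τ') ^ 2) ^ 2 / 2) ≤ p → (lawBW (MeasureTheory.volume : MeasureTheory.Measure ℂ)).real (stepBad T u R {b : ℂ | (δ : ℂ) * b ∈ V} g V δ K i ∩ {c | ∀ z ∈ Kc, ∃ x ∈ (c.1 : Set ℂ), dist x (z / (δ : ℂ)) < r_v}) ≤ 3 * p * ((Ca + v + 1) ^ 2 * ((400 * u / R) ^ ηa + v)) + (2 * (R + 2 * u) / u + 1) ^ 2 * p ^ 2 * ((Ca + v + 1) ^ 2 * ((400 * u / R) ^ ηa + v)) + ((2 * (R + 2 * u) / u + 1) ^ 2) ^ 2 * p ^ 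3)
    (hSE : ∀ (Λ W W' r_b r_g r_f r_h ℓ₀ ℓ₀' η s₀ m₁ D₀ : ℝ), 1 ≤ Λ → 0 < W → 0 < W' → 0 < r_b → 0 < r_g → 0 < r_f → 0 < r_h → 0 < ℓ₀ → 0 < ℓ₀' → 0 < η → 0 < s₀ → 0 < m₁ → 0 < D₀ → ∀ᶠ δ : ℝ in nhdsWithin 0 (Set.Ioi 0), 0 < δ ∧ δ < 1 ∧ 1 ≤ rvS δ ∧ 6 * rvS δ ≤ s₀ / δ ∧ 5 * Λ ^ 3 * rvS δ ≤ s₀ / δ ∧ 8 * (δ * rvS δ) ≤ r_g ∧ 8 * Λ * (δ * rvS δ) ≤ r_f ∧ δ * (2 * rvS δ) ≤ ℓ₀ ∧ δ * (2 * Λ * rvS δ) ≤ ℓ₀' ∧ δ * (2 * Λ * rvS δ) < η ∧ δ * (Λ ^ 2 * (4 * Λ * rvS δ) + rvS δ) ≤ r_b ∧ Λ ^ 2 * (4 * Λ * rvS δ) + rvS δ ≤ m₁ / δ - rvS δ ∧ δ * (10 * Λ ^ 3 * rvS δ) ≤ r_b ∧ τS W δ ≤ 2 * rvS δ ∧ τS'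 W' Λ δ ≤ 2 * Λ * rvS δ ∧ 10 * Λ ^ 3 * rvS δ + Λ * (3 * (2 * Λ * rvS δ) + τS' W' Λ δ) ≤ 2 * (10 * Λ ^ 3 * rvS δ) ∧ 10 * Λ ^ 3 * rvS δ + 6 * rvS δ + τS W δ ≤ 2 * (10 * Λ ^ 3 * rvS δ) ∧ 400 * (10 * Λ ^ 3 * rvS δ) < RS δ ∧ RS δ ≤ D₀ / δ ∧ 1 ≤ 100 * (10 * Λ ^ 3 * rvS δ) ∧ 0 < τS W δ ∧ 0 < τS' W' Λ δ ∧ δ * (RS δ + 9 * (10 * Λ ^ 3 * rvS δ)) ≤ m₁ / 3 ∧ δ * (2 * (10 * Λ ^ 3 * rvS δ)) ≤ r_h)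
    (hFS : ∀ (A W W' Λ m Ca ηa ρ₀ : ℝ), 0 < A → 0 < W → 0 < W' → 1 ≤ Λ → 0 < m → 0 ≤ Ca → 0 < ηa → 0 < ρ₀ → Filter.Tendsto (fun δ : ℝ => FS A W W' Λ m Ca ηa ρ₀ δ) (nhdsWithin 0 (Set.Ioi 0)) (nhds 0)) :
    Literature.Probability.Percolation.VoronoiAnnealedOneArm → Sig.unitW := by
  intro hF1 R g₀ U hU hRU gd₀ gi₀ V hV hVb hRV hVU K A₀ A₂ hK hA₀ hA₂
  classical
  haveI := isProbabilityMeasure_lawBW_volume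
  set μ : Measure (PointConfig ℂ × PointConfig ℂ) := lawBW (volume : Measure ℂ) with hμ
  set g : ℂ → ℂ := U.indicator g₀ with hgdef
  have heqU : EqOn g₀ g U := fun x hx => (Set.indicator_of_mem hx g₀).symm
  have hgm : Measurable g := measurable_indicator_of_continuousOn hU gd₀.continuousOn
  have gd : DifferentiableOn ℂ g U := gd₀.congr fun x hx => (heqU hx).symm
  have gi : InjOn g U := fun x hx y hy h => gi₀ hx hy (by rw [heqU hx, heqU hy]; exact h)
  set B₀ : ℝ → Set ℂ := fun δ => A₀ δ ∩ K δ with hB₀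
  set B₂ : ℝ → Set ℂ := fun δ => A₂ δ ∩ K δ with hB₂
  have hB₀att : IsAttachment R 0 B₀ := gt_isAttachment_inter hA₀ hK
  have hB₂att : IsAttachment R 2 B₂ := gt_isAttachment_inter hA₂ hK
  have hBK₀ : ∀ δ, B₀ δ ⊆ K δ := fun δ => inter_subset_right
  have hBK₂ : ∀ δ, B₂ δ ⊆ K δ := fun δ => inter_subset_right
  set Kc : Set ℂ := closure V with hKc
  have hKcc : IsCompact Kc := hVb.isCompact_closure
  have hKcU : Kc ⊆ U := hVU
  have hVKc : V ⊆ Kc := subset_closure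
  have hΩc : IsCompact (closure R.carrier) := R.isBounded.isCompact_closure
  obtain ⟨d₀, hd₀, hthick⟩ := hΩc.exists_thickening_subset_open hV hRV
  -- bi-Lipschitz package of `g`
  obtain ⟨r_b, Λ, hr_b, hΛ, hballU, hup, hlow, hsurj, -⟩ := transport_bilipschitz g U Kc hU hKcc hKcU gd gi
  have hΛ0 : 0 < Λ := lt_of_lt_of_le one_pos hΛ
  -- inverse and packages
  obtain ⟨hU'open, hfd, hfi, hleftU, -, -⟩ := univalent_inverse g U hU gd gi
  set finv : ℂ → ℂ := Function.invFunOn g U with hfinv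
  obtain ⟨Wg, ℓ₀, r_g, hℓ₀, hr_g, -, hDg0⟩ := uniform_defectPackage g U Kc hU hKcc hKcU gd gi
  have hKc'c : IsCompact (g '' Kc) := hKcc.image_of_continuousOn (gd.continuousOn.mono hKcU)
  obtain ⟨Wf, ℓ₀', r_f, hℓ₀', hr_f, -, hDf0⟩ := uniform_defectPackage finv (g '' U) (g '' Kc) hU'open hKc'c
    (image_mono hKcU) hfd hfi
  set W : ℝ := max Wg 1 with hWdef
  set W' : ℝ := max Wf 1 with hW'def
  have hW : 0 < W := lt_of_lt_of_le one_pos (le_max_right _ _)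
  have hW' : 0 < W' := lt_of_lt_of_le one_pos (le_max_right _ _)
  have hDg : ∀ x ∈ Kc, _ := fun x hx => defectPackage_mono_W (le_max_left Wg 1) (hDg0 x hx)
  have hDf : ∀ x' ∈ g '' Kc, _ := fun x' hx' => defectPackage_mono_W (le_max_left Wf 1) (hDf0 x' hx')
  -- derivative data
  obtain ⟨r_h, Lh, m, Λh, hr_h, -, hm, -, -, hderivs, -, -⟩ := holo_uniform_bounds g U Kc hU hKcc hKcU gd gi
  -- localisation radius and injectivity moduli
  set s₀ : ℝ := min (min r_b r_g) (min (r_f / Λ) r_h) / 2 with hs₀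
  have hs₀pos : 0 < s₀ := by positivity
  have hmin1 : min (min r_b r_g) (min (r_f / Λ) r_h) ≤ r_b := (min_le_left _ _).trans (min_le_left _ _)
  have hmin2 : min (min r_b r_g) (min (r_f / Λ) r_h) ≤ r_g := (min_le_left _ _).trans (min_le_right _ _)
  have hmin3 : min (min r_b r_g) (min (r_f / Λ) r_h) ≤ r_f / Λ :=
    (min_le_right _ _).trans (min_le_left _ _)
  have hs₀le_b : s₀ ≤ r_b := by rw [hs₀]; linarith
  have hs₀le_g : s₀ ≤ r_g := by rw [hs₀]; linarith
  have hs₀le_f : Λ * s₀ ≤ r_f := by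
    have h1 : Λ * s₀ ≤ Λ * (r_f / Λ) := mul_le_mul_of_nonneg_left (by rw [hs₀]; linarith [div_nonneg hr_f.le hΛ0.le]) hΛ0.le
    rw [mul_div_cancel₀ _ hΛ0.ne'] at h1
    exact h1
  obtain ⟨η₁, hη₁, hmod₁⟩ := hub_uniform_injOn hKcc hKcU gd.continuousOn gi (half_pos hr_b)
  obtain ⟨η₂, hη₂, hmod₂⟩ := hub_uniform_injOn hKcc hKcU gd.continuousOn gi hs₀pos
  set η : ℝ := min η₁ η₂ with hηdef
  have hη : 0 < η := lt_min hη₁ hη₂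
  -- far attachments, bounding disc, arm constants
  obtain ⟨D₀, hD₀, hfarev⟩ := far_attachment R B₀ B₂ hB₀att hB₂att
  obtain ⟨ρ₀, hρ₀b, hVρ₀⟩ := hVb.subset_closedBall_lt r_b (0 : ℂ)
  have hρ₀ : 0 < ρ₀ := hr_b.trans hρ₀b
  have hKcρ₀ : Kc ⊆ closedBall (0 : ℂ) ρ₀ := closure_minimal hVρ₀ isClosed_closedBall
  obtain ⟨Ca, ηa, hηa, hCa, harm⟩ := armLoc_bound hF1
  set A : ℝ := 10 * Λ ^ 3 with hAdef
  have hA : 0 < A := by positivity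
  -- the eventual facts
  have hSEv := hSE Λ W W' r_b r_g r_f r_h ℓ₀ ℓ₀' η s₀ (d₀ / 2) D₀ hΛ hW hW' hr_b hr_g hr_f hr_h hℓ₀ hℓ₀'
    hη hs₀pos (half_pos hd₀) hD₀
  have hKev := gt_eventually_domainFamily hK (show (0 : ℝ) < d₀ / 3 by positivity)
  have hFSv := hFS A W W' Λ m Ca ηa ρ₀ hA hW hW' hΛ hm hCa hηa hρ₀
  -- abbreviations for the two events
  set X : ℝ → ℝ := fun δ => μ.real {c | (PointConfig.restrict {b : ℂ | (δ : ℂ) * b ∈ V} c.1,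
      PointConfig.restrict {b : ℂ | (δ : ℂ) * b ∈ V} c.2) ∈ graphCross (K δ) (A₀ δ) (A₂ δ) δ} with hX
  set Y : ℝ → ℝ := fun δ => μ.real (hGraphCross (K δ) (A₀ δ) (A₂ δ) g₀ V δ) with hY
  have hmain : ∀ᶠ δ : ℝ in 𝓝[>] 0, |X δ - Y δ| ≤ FS A W W' Λ m Ca ηa ρ₀ δ := by
    filter_upwards [hSEv, hKev, hfarev] with δ hS hKδ hfarδ
    obtain ⟨hδ, hδ1, hrv1, hs₁, hs₂, h8g, h8f, hl₀, hl₀', hηlt, hfit, hfit', hfitu, hτ, hτ',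
      hρD, hρD', hR, hRfar, hu1, hτpos, hτ'pos, hwin, hrh⟩ := hS
    obtain ⟨hKm, hKth⟩ := hKδ
    have hδ' : (δ : ℂ) ≠ 0 := Complex.ofReal_ne_zero.2 hδ.ne'
    set rv : ℝ := rvS δ with hrvdef
    have hrv : 0 < rv := lt_of_lt_of_le one_pos hrv1
    set u : ℝ := A * rv with hudef
    have hu10 : 10 * Λ ^ 3 * rv = u := by rw [hudef, hAdef]
    have hupos : 0 < u := by positivity
    set R' : ℝ := RS δ with hR'def
    set s : ℝ := s₀ / δ with hsdef
    have hδs : δ * s = s₀ := by rw [hsdef]; field_simp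
    set τ : ℝ := τS W δ with hτdef
    set τ' : ℝ := τS' W' Λ δ with hτ'def
    set m₁ : ℝ := d₀ / 2 with hm₁def
    set Wd : Set ℂ := {b : ℂ | (δ : ℂ) * b ∈ V} with hWd
    set v : ℝ := vS ρ₀ δ with hvdef
    set p : ℝ := pS A W W' Λ m δ with hpdef
    set good : Set (PointConfig ℂ × PointConfig ℂ) :=
      {c | ∀ z ∈ Kc, ∃ x ∈ (c.1 : Set ℂ), dist x (z / (δ : ℂ)) < rv} with hgooddef
    have hu2 : 2 * Λ ^ 2 * rv ≤ u := by
      rw [← hu10]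
      have h1 : Λ ^ 2 * rv ≤ Λ ^ 3 * rv := by
        have := mul_le_mul_of_nonneg_left hΛ (by positivity : (0 : ℝ) ≤ Λ ^ 2 * rv)
        linarith only [this]
      have h2 : 0 ≤ Λ ^ 3 * rv := by positivity
      linarith only [h1, h2]
    have h2rv : 2 * rv ≤ u := by
      have : rv ≤ Λ ^ 2 * rv := by
        have := mul_le_mul_of_nonneg_left (one_le_pow₀ hΛ : (1 : ℝ) ≤ Λ ^ 2) hrv.le
        linarith only [this]
      linarith only [this, hu2]
    have hne : (closure R.carrier).Nonempty :=
      ⟨R.pt 0, (R.arc_subset_frontier 0).trans frontier_subset_closure (R.pt_mem_arc_self 0)⟩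
    have hthick3 : thickening (d₀ / 3) (closure R.carrier) ⊆ V :=
      (thickening_mono (by linarith) _).trans hthick
    have hKV : K δ ⊆ V := hKth.trans hthick3
    have hKKc : K δ ⊆ Kc := hKV.trans hVKc
    have hnear : ∀ x : ℂ, infDist x (closure R.carrier) ≤ d₀ / 2 → ∀ w : ℂ, dist w x < d₀ / 2 →
        w ∈ V := by
      intro x hx w hw
      apply hthick
      rw [mem_thickening_iff_infDist_lt hne]
      calc infDist w (closure R.carrier) ≤ infDist x (closure R.carrier) + dist w x :=
          infDist_le_infDist_add_dist
        _ < d₀ / 2 + d₀ / 2 := by linarith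
        _ = d₀ := by ring
    have hKdeep : ∀ x ∈ K δ, closedBall x m₁ ⊆ V := by
      intro x hx w hw
      have hx' : infDist x (closure R.carrier) < d₀ / 3 :=
        (mem_thickening_iff_infDist_lt hne).1 (hKth hx)
      apply hthick
      rw [mem_thickening_iff_infDist_lt hne]
      have := mem_closedBall.1 hw
      calc infDist w (closure R.carrier) ≤ infDist x (closure R.carrier) + dist w x :=
          infDist_le_infDist_add_dist
        _ < d₀ / 3 + d₀ / 2 := by linarith
        _ ≤ d₀ := by linarith
    set M : ℕ := MS ρ₀ A δ with hMdef
    set box : Finset (ℤ × ℤ) := (Finset.Icc (-(M : ℤ)) M) ×ˢ (Finset.Icc (-(M : ℤ)) M) with hbox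
    set T : Finset (ℤ × ℤ) := box.filter
      (fun k => infDist ((δ : ℂ) * sqCentre u k) (closure R.carrier) ≤ d₀ / 2) with hTdef
    have hTmem : ∀ k ∈ T, infDist ((δ : ℂ) * sqCentre u k) (closure R.carrier) ≤ d₀ / 2 :=
      fun k hk => (Finset.mem_filter.1 hk).2
    have hδu : δ * u ≤ d₀ / 6 := by
      have h1 : δ * u ≤ δ * (RS δ + 9 * u) := mul_le_mul_of_nonneg_left (by
        have : 0 ≤ RS δ := by rw [RS]; positivity
        linarith) hδ.le
      linarith [hwin]
    have hcover : ∀ q : ℂ, (δ : ℂ) * q ∈ K δ → sqIdx u q ∈ T := by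
      intro q hq
      refine Finset.mem_filter.2 ⟨?_, ?_⟩
      · refine sqIdx_mem_box hupos hδ (Nat.le_ceil _) ?_
        have := hVρ₀ (hKV hq)
        rwa [mem_closedBall, dist_zero_right] at this
      · have hq' : infDist ((δ : ℂ) * q) (closure R.carrier) < d₀ / 3 :=
          (mem_thickening_iff_infDist_lt hne).1 (hKth hq)
        have hdz : dist ((δ : ℂ) * sqCentre u (sqIdx u q)) ((δ : ℂ) * q) ≤ δ * u := by
          rw [dist_real_mul δ hδ]
          exact mul_le_mul_of_nonneg_left (dist_sqCentre_sqIdx_le hupos q) hδ.le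
        calc infDist ((δ : ℂ) * sqCentre u (sqIdx u q)) (closure R.carrier)
            ≤ infDist ((δ : ℂ) * q) (closure R.carrier) + dist ((δ : ℂ) * sqCentre u (sqIdx u q)) ((δ : ℂ) * q) :=
              infDist_le_infDist_add_dist
          _ ≤ d₀ / 3 + d₀ / 6 := by linarith
          _ = d₀ / 2 := by ring
    -- windows and derivative balls of the squares of `T`
    have hwinT : ∀ k ∈ T, ∀ x : ℂ, dist x (sqCentre u k) ≤ RS δ + 8 * u → (δ : ℂ) * x ∈ V := by
      intro k hk x hx
      refine hnear _ (hTmem k hk) _ ?_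
      rw [dist_real_mul δ hδ]
      have h1 : δ * dist x (sqCentre u k) ≤ δ * (RS δ + 9 * u) :=
        mul_le_mul_of_nonneg_left (by linarith) hδ.le
      linarith
    have hcentreV : ∀ k ∈ T, (δ : ℂ) * sqCentre u k ∈ V := fun k hk =>
      hnear _ (hTmem k hk) _ (by rw [dist_self]; positivity)
    have hderivT : ∀ k ∈ T, ∀ x ∈ closedBall ((δ : ℂ) * sqCentre u k) (δ * (2 * u)),
        HasDerivAt g (deriv g x) x ∧ m ≤ ‖deriv g x‖ := by
      intro k hk x hx
      have hxb : x ∈ closedBall ((δ : ℂ) * sqCentre u k) r_h := closedBall_subset_closedBall hrh hx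
      obtain ⟨h1, -, h3, -, -⟩ := hderivs _ (hVKc (hcentreV k hk)) x hxb
      exact ⟨h1, h3⟩
    have hinjT : ∀ k ∈ T, InjOn g (closedBall ((δ : ℂ) * sqCentre u k) (δ * (2 * u))) := by
      intro k hk
      refine gi.mono fun x hx => (subset_closure.trans hKcU) (hnear _ (hTmem k hk) _ ?_)
      have := mem_closedBall.1 hx
      have h0 : 0 ≤ δ * RS δ := by rw [RS]; positivity
      linarith
    have hmod : ∀ z ∈ Kc, ∀ w ∈ Kc, r_b / 2 ≤ dist z w → η ≤ dist (g z) (g w) :=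
      fun z hz w hw h => (min_le_left _ _).trans (hmod₁ z hz w hw h)
    have hmods : ∀ z ∈ Kc, ∀ w ∈ Kc, δ * s ≤ dist z w → η ≤ dist (g z) (g w) :=
      fun z hz w hw h => (min_le_right _ _).trans (hmod₂ z hz w hw (by rwa [hδs] at h))
    have hfit2 : δ * (Λ ^ 2 * (2 * Λ * rv) + rv) ≤ r_b := by
      have : δ * (Λ ^ 2 * (2 * Λ * rv) + rv) ≤ δ * (Λ ^ 2 * (4 * Λ * rv) + rv) :=
        mul_le_mul_of_nonneg_left (by
          have : 0 ≤ Λ ^ 2 * (2 * Λ * rv) := by positivity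
          linarith only [this]) hδ.le
      linarith only [this, hfit]
    have hfit2' : Λ ^ 2 * (2 * Λ * rv) + rv ≤ m₁ / δ - rv := by
      have : 0 ≤ Λ ^ 2 * (2 * Λ * rv) := by positivity
      linarith only [this, hfit']
    have hgood : good ⊆ stepGood u Wd g V δ (K δ) := fun c hc =>
      vc_stepGood hδ hrv hΛ hVKc hu2 hKKc hKdeep hup hlow hsurj hmod hηlt hr_b hfit2 hfit2' hc
    have hleft : ∀ x ∈ V, finv (g x) = x := fun x hx => hleftU x (subset_closure.trans hKcU hx)
    have hvoidle : μ.real {c : PointConfig ℂ × PointConfig ℂ | ∃ z ∈ Kc, ∀ x ∈ (c.1 : Set ℂ),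
        rv ≤ dist x (z / (δ : ℂ))} ≤ v := by
      have hs3 : rv ≤ 3 * (ρ₀ / δ) := by
        rw [show 3 * (ρ₀ / δ) = (3 * ρ₀) / δ by ring, le_div_iff₀ hδ]
        have h1 : δ * rv ≤ δ * u := mul_le_mul_of_nonneg_left (by linarith only [h2rv, hrv]) hδ.le
        nlinarith only [h1, hfitu, hρ₀b, hρ₀, hδ, hrv]
      have := void_global_bound Kc ρ₀ δ rv hKcρ₀ hδ hrv hs3
      simpa only [hvdef, vS, hrvdef, rvS] using this
    have hfit0 : 2 * rv ≤ m₁ / δ - rv := by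
      have h1 : 2 * rv ≤ Λ ^ 2 * (2 * Λ * rv) := by
        have := mul_le_mul_of_nonneg_left (one_le_pow₀ hΛ : (1 : ℝ) ≤ Λ ^ 3)
          (by positivity : (0 : ℝ) ≤ 2 * rv)
        linarith only [this]
      linarith only [h1, hfit2', hrv]
    have hb : ∀ i ∈ T, μ.real (stepBad T u (RS δ) Wd g V δ (K δ) i ∩ good) ≤
        3 * p * ((Ca + v + 1) ^ 2 * ((400 * u / RS δ) ^ ηa + v)) +
        (2 * (RS δ + 2 * u) / u + 1) ^ 2 * p ^ 2 * ((Ca + v + 1) ^ 2 * ((400 * u / RS δ) ^ ηa + v)) +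
        ((2 * (RS δ + 2 * u) / u + 1) ^ 2) ^ 2 * p ^ 3 := by
      intro i hi
      refine hPS g V Kc (K δ) δ rv Λ m₁ u (RS δ) m Ca ηa v p τ τ' T i hδ hrv hΛ hVKc h2rv hupos hu1
        hKKc hKdeep hKm hfit0 hτpos hτ hτ'pos hτ' hgm hm hderivT hinjT hR
        (hwinT i hi) hCa hηa harm (by rw [hvdef, vS]; positivity) hvoidle hi ?_ ?_
      · -- the defect-to-local-event implication
        intro k hk c hvoid hdef
        exact vc_defLoc_of_defSq hδ hrv hΛ hVKc hKKc hKdeep hup hlow hsurj hmod hmods hleft hDg hDf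
          hs₁ hs₂ (by rw [hδs]; linarith only [hs₀le_b]) (by rw [hδs]; exact hs₀le_g)
          (by rw [hδs]; exact hs₀le_f) h8g h8f hl₀ hl₀' hτ hτ' hηlt hr_b hfit hfit' hfitu hρD hρD'
          hvoid hupos hdef
      · -- the four Poisson bounds sum to `p`
        exact le_of_eq (by rw [hpdef, pS])
    have hfar : ∀ i ∈ T, (∀ x : ℂ, (δ : ℂ) * x ∈ B₀ δ → D₀ / δ < dist x (sqCentre u i)) ∨
        (∀ x : ℂ, (δ : ℂ) * x ∈ B₂ δ → D₀ / δ < dist x (sqCentre u i)) := fun i _ => hfarδ _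
    have htel := abs_window_sub_pull_le (T := T) (b := _) hupos hR hRfar hKV hfar hcover hgood hb
    -- identify the two events with `X δ`, `Y δ`
    have hXe : X δ = μ.real {c | (PointConfig.restrict Wd c.1, PointConfig.restrict Wd c.2) ∈
        graphCross (K δ) (B₀ δ) (B₂ δ) δ} := by
      simp only [hX, hB₀, hB₂, ← gt_graphCross_inter, hWd]
    have hYe : Y δ = μ.real (hGraphCross (K δ) (B₀ δ) (B₂ δ) g V δ) := by
      simp only [hY, hB₀, hB₂, ← gt_hGraphCross_inter]
      rw [hGraphCross_congr (h := g₀) (h' := g) (fun x hx => heqU (subset_closure.trans hKcU hx)) hKV]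
    rw [hXe, hYe]
    refine htel.trans ?_
    have hgoodc : μ.real goodᶜ ≤ v := by
      refine le_trans (measureReal_mono ?_) hvoidle
      intro c hc
      simp only [hgooddef, mem_compl_iff, mem_setOf_eq, not_forall, not_exists, not_and, not_lt] at hc
      obtain ⟨z, hz, hzc⟩ := hc
      exact ⟨z, hz, fun x hx => hzc x hx⟩
    have hcard : (T.card : ℝ) ≤ cardS ρ₀ A δ := by
      have h1 : T.card ≤ box.card := Finset.card_filter_le _ _
      have h2 : box.card = (2 * M + 1) ^ 2 := by
        rw [hbox, Finset.card_product, Int.card_Icc]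
        have : (↑M + 1 - -(M : ℤ)).toNat = 2 * M + 1 := by omega
        rw [this]; ring
      rw [cardS, ← hMdef]
      exact_mod_cast (h1.trans h2.le)
    have hbnonneg : 0 ≤ 3 * p * ((Ca + v + 1) ^ 2 * ((400 * u / RS δ) ^ ηa + v)) +
        (2 * (RS δ + 2 * u) / u + 1) ^ 2 * p ^ 2 * ((Ca + v + 1) ^ 2 * ((400 * u / RS δ) ^ ηa + v)) +
        ((2 * (RS δ + 2 * u) / u + 1) ^ 2) ^ 2 * p ^ 3 := by
      have hp0 : 0 ≤ p := by rw [hpdef, pS, τS, τS']; positivity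
      have hv0 : 0 ≤ v := by rw [hvdef, vS]; positivity
      have hR0 : 0 ≤ RS δ := by rw [RS]; positivity
      have hrp : 0 ≤ (400 * u / RS δ) ^ ηa := Real.rpow_nonneg (by positivity) _
      positivity
    calc μ.real goodᶜ + T.card * (3 * p * ((Ca + v + 1) ^ 2 * ((400 * u / RS δ) ^ ηa + v)) +
          (2 * (RS δ + 2 * u) / u + 1) ^ 2 * p ^ 2 * ((Ca + v + 1) ^ 2 * ((400 * u / RS δ) ^ ηa + v)) +
          ((2 * (RS δ + 2 * u) / u + 1) ^ 2) ^ 2 * p ^ 3)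
        ≤ v + cardS ρ₀ A δ * (3 * p * ((Ca + v + 1) ^ 2 * ((400 * u / RS δ) ^ ηa + v)) +
          (2 * (RS δ + 2 * u) / u + 1) ^ 2 * p ^ 2 * ((Ca + v + 1) ^ 2 * ((400 * u / RS δ) ^ ηa + v)) +
          ((2 * (RS δ + 2 * u) / u + 1) ^ 2) ^ 2 * p ^ 3) :=
          add_le_add hgoodc (mul_le_mul_of_nonneg_right hcard hbnonneg)
      _ = FS A W W' Λ m Ca ηa ρ₀ δ := by
          simp only [FS, BS, NS, hvdef, hpdef, hudef, hrvdef]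
  have habs : Tendsto (fun δ => |X δ - Y δ|) (𝓝[>] 0) (𝓝 0) :=
    squeeze_zero' (Eventually.of_forall fun δ => abs_nonneg _) hmain hFSv
  have := (tendsto_zero_iff_abs_tendsto_zero _).2 habs
  simpa only [hX, hY] using this

end Summit.CriticalPhenomena.CardyFormulaZ2.Cruxes.VoronoiHubFromSmirnov.MoebiusExactDelaunayDilationWard

end
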